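import Summits.HubbardSuperconductivity.HubbardSuperconductivity.Theorems.NodalWardXYVisonPairCostIRDefs
import Summits.HubbardSuperconductivity.HubbardSuperconductivity.Theorems.NodalWardXYVisonPairCostRankWindow
import Literature.MathematicalPhysics.QuantumLattice.TorusResolventSummationByParts
import Literature.MathematicalPhysics.QuantumLattice.FermionTorusPlaneWaveInversion

/-!
# Crux `NodalWardXY.VisonPairCost` (stmt-HubbardSuperconductivity-1266), line `Sketch`:
# the stub `stub_freeResolventDecay : FreeResolventDecay` — decay of the free torus resolvent

`freeG L μ Δ₀ t = (N₀ + it)⁻¹`, `N₀ = visonNambu L μ Δ₀ 0`, is the resolvent at imaginary energy of the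
FREE (string-less, translation-invariant) d-wave BdG Nambu matrix on the fermionic torus `(ℤ/Lℤ)²`
(vocabulary: `…VisonPairCostDefs.lean`, `…VisonPairCostIRDefs.lean`).  We prove (IR-5)
`FreeResolventDecay`: for `t > 0` and orbitals `a, b` at column distance `d ≥ 1`,
`‖G_t(a,b)‖ ≤ Φ₁ᶜ/(4d)` and `‖G_t(a,b)‖ ≤ (π/4) Φ₂ᶜ/d²` (and the same in the row direction), with the
grid-line symbol integrals `colPhi1/2`, `rowPhi1/2` of IRDefs.

* **Plane waves** (`sum_visonNambu_zero_mul_torusChar`): `N₀` maps the plane wave `y ↦ χ_k(y − w)` in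
  orbital `σ'` to `χ_k(· − w) N̂(k)_{·σ'}`, `N̂(k) = [[ξ, −Δ̂],[−Δ̂, −ξ]]`, `ξ = −2cos k₁ − 2cos k₂ − μ`,
  `Δ̂ = 2Δ₀(cos k₁ − cos k₂)` (`kᵢ = 2π·(momentum)ᵢ/L`): the hopping / pairing stencils of
  `visonHop L 0`, `visonPair L Δ₀ 0` are `−Σᵢ(δ_{y,x+eᵢ} + δ_{y,x−eᵢ})`, `Δ₀ Σᵢ gᵢ (δ_{y,x+eᵢ} + δ_{y,x−eᵢ})`.
* **Symbol algebra** (`symb_mul_key`): `(N̂(k) + it) symb(k) = 1` (`N̂² = (ξ² + Δ̂²)·1`).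
* **Fourier representation** (`freeG_apply_eq`): by the tree's plane-wave inversion lemma
  (`inv_apply_eq_sum_torusChar`, `sum_torusChar_mul_eq_sum_fin_fin` of
  `Literature/…/FermionTorusPlaneWaveInversion.lean`),
  `G_t(a,b) = L⁻² Σ_{j₁ j₂} ω₁^{j₁} ω₂^{j₂} symb(2πj₁/L, 2πj₂/L)_{σσ'}`, `ωᵢ = e^{2πi nᵢ/L}`,
  `n = (column, row)(a) − (column, row)(b)`.
* **Decay** (`stub_freeResolventDecay`): the symbol is `C²` and `2π`-periodic in each momentum
  (`symb_contDiff_left/right`, `symb_periodic_left/right`), so the tree's periodic summation by parts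
  (`norm_twisted_double_grid_sum_le` of `Literature/…/TorusResolventSummationByParts.lean`:
  `|1 − ω| ≥ 4d/L`, `Σ|Δg| ≤ ∫|g'|`, second differences under the integral) gives the two bounds with
  the `(σ,σ')` term of `colPhi1/2` (resp. `rowPhi1/2`); the remaining terms are nonnegative.

References: the crux docstring (`Theses/NodalWardXY.lean`); Friedli–Velenik (2017) §10.4 (Fourier
analysis on the discrete torus).  No definition is introduced.
-/

noncomputable section

-- tree namespace Summit.HubbardSuperconductivity.HubbardSuperconductivity (D-0017)
set_option linter.dupNamespace false

namespace Summit.HubbardSuperconductivity.HubbardSuperconductivity.Theorems.VisonPairCost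

open Literature.Probability.LatticeModels Literature.MathematicalPhysics.QuantumLattice
open Summit.HubbardSuperconductivity.HubbardSuperconductivity.Theses.NodalWardXY
open Finset
open scoped Matrix Real ComplexConjugate

/-! ### The free symbol: regularity, periodicity, and the key identity `(N̂ + it)·symb = 1` -/

section Symbol

variable (μ Δ₀ t : ℝ)

/-- The entries of `N̂(k₁,k₂) − it` (numerators of `symb`) are `C²` in `k₁`. -/
private theorem symbNum_contDiff_left (r : ℝ) (σ σ' : Fin 2) :
    ContDiff ℝ 2 (fun s : ℝ =>
      (if σ = 0 then (if σ' = 0 then ((xiS μ s r : ℂ) - (t : ℂ) * Complex.I) else (-(gapS Δ₀ s r) : ℂ))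
        else (if σ' = 0 then (-(gapS Δ₀ s r) : ℂ) else (-(xiS μ s r : ℂ) - (t : ℂ) * Complex.I)))) := by
  have hof : ContDiff ℝ 2 (fun x : ℝ => (x : ℂ)) := Complex.ofRealCLM.contDiff
  have hξ : ContDiff ℝ 2 (fun s => xiS μ s r) := by unfold xiS; fun_prop
  have hΔ : ContDiff ℝ 2 (fun s => gapS Δ₀ s r) := by unfold gapS; fun_prop
  have hA : ContDiff ℝ 2 (fun s => ((xiS μ s r : ℝ) : ℂ) - (t : ℂ) * Complex.I) :=
    (hof.comp hξ).sub contDiff_const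
  have hB : ContDiff ℝ 2 (fun s => (-(gapS Δ₀ s r) : ℂ)) := (hof.comp hΔ).neg
  have hC : ContDiff ℝ 2 (fun s => -((xiS μ s r : ℝ) : ℂ) - (t : ℂ) * Complex.I) :=
    (hof.comp hξ).neg.sub contDiff_const
  by_cases h0 : σ = 0 <;> by_cases h1 : σ' = 0 <;> simp only [h0, h1, if_true, if_false]
  exacts [hA, hB, hB, hC]

/-- The entries of `N̂(k₁,k₂) − it` are `C²` in `k₂`. -/
private theorem symbNum_contDiff_right (r : ℝ) (σ σ' : Fin 2) :
    ContDiff ℝ 2 (fun s : ℝ =>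
      (if σ = 0 then (if σ' = 0 then ((xiS μ r s : ℂ) - (t : ℂ) * Complex.I) else (-(gapS Δ₀ r s) : ℂ))
        else (if σ' = 0 then (-(gapS Δ₀ r s) : ℂ) else (-(xiS μ r s : ℂ) - (t : ℂ) * Complex.I)))) := by
  have hof : ContDiff ℝ 2 (fun x : ℝ => (x : ℂ)) := Complex.ofRealCLM.contDiff
  have hξ : ContDiff ℝ 2 (fun s => xiS μ r s) := by unfold xiS; fun_prop
  have hΔ : ContDiff ℝ 2 (fun s => gapS Δ₀ r s) := by unfold gapS; fun_prop
  have hA : ContDiff ℝ 2 (fun s => ((xiS μ r s : ℝ) : ℂ) - (t : ℂ) * Complex.I) :=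
    (hof.comp hξ).sub contDiff_const
  have hB : ContDiff ℝ 2 (fun s => (-(gapS Δ₀ r s) : ℂ)) := (hof.comp hΔ).neg
  have hC : ContDiff ℝ 2 (fun s => -((xiS μ r s : ℝ) : ℂ) - (t : ℂ) * Complex.I) :=
    (hof.comp hξ).neg.sub contDiff_const
  by_cases h0 : σ = 0 <;> by_cases h1 : σ' = 0 <;> simp only [h0, h1, if_true, if_false]
  exacts [hA, hB, hB, hC]

variable {t}

/-- The free symbol is `C²` in the first momentum (`t ≠ 0`: the denominator `ξ² + Δ̂² + t²` is `≥ t²`). -/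
theorem symb_contDiff_left (ht : t ≠ 0) (r : ℝ) (σ σ' : Fin 2) :
    ContDiff ℝ 2 (fun s => symb μ Δ₀ t s r σ σ') := by
  have hof : ContDiff ℝ 2 (fun x : ℝ => (x : ℂ)) := Complex.ofRealCLM.contDiff
  have hD : ContDiff ℝ 2 (fun s => ((xiS μ s r) ^ 2 + (gapS Δ₀ s r) ^ 2 + t ^ 2)⁻¹) := by
    refine ContDiff.inv (by unfold xiS gapS; fun_prop) fun s => ?_
    positivity
  unfold symb
  exact (hof.comp hD).mul (symbNum_contDiff_left μ Δ₀ t r σ σ')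

/-- The free symbol is `C²` in the second momentum. -/
theorem symb_contDiff_right (ht : t ≠ 0) (r : ℝ) (σ σ' : Fin 2) :
    ContDiff ℝ 2 (fun s => symb μ Δ₀ t r s σ σ') := by
  have hof : ContDiff ℝ 2 (fun x : ℝ => (x : ℂ)) := Complex.ofRealCLM.contDiff
  have hD : ContDiff ℝ 2 (fun s => ((xiS μ r s) ^ 2 + (gapS Δ₀ r s) ^ 2 + t ^ 2)⁻¹) := by
    refine ContDiff.inv (by unfold xiS gapS; fun_prop) fun s => ?_
    positivity
  unfold symb
  exact (hof.comp hD).mul (symbNum_contDiff_right μ Δ₀ t r σ σ')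

variable (t)

/-- The free symbol is `2π`-periodic in the first momentum. -/
theorem symb_periodic_left (r : ℝ) (σ σ' : Fin 2) :
    Function.Periodic (fun s => symb μ Δ₀ t s r σ σ') (2 * π) := fun s => by
  simp only [symb, xiS, gapS, Real.cos_add_two_pi]

/-- The free symbol is `2π`-periodic in the second momentum. -/
theorem symb_periodic_right (r : ℝ) (σ σ' : Fin 2) :
    Function.Periodic (fun s => symb μ Δ₀ t r s σ σ') (2 * π) := fun s => by
  simp only [symb, xiS, gapS, Real.cos_add_two_pi]

variable {t}

/-- **Key identity** `(N̂(k) + it) · symb(k) = 1₂`, i.e. `symb = (N̂ + it)⁻¹ = (N̂ − it)/(ξ² + Δ̂² + t²)`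
(`N̂ = [[ξ, −Δ̂],[−Δ̂, −ξ]]`, `N̂² = (ξ² + Δ̂²)·1`), entrywise. -/
theorem symb_mul_key (ht : t ≠ 0) (k₁ k₂ : ℝ) (σ σ'' : Fin 2) :
    ∑ σ' : Fin 2, ((if σ = 0 then (if σ' = 0 then (xiS μ k₁ k₂ : ℂ) else (-(gapS Δ₀ k₁ k₂) : ℂ))
        else (if σ' = 0 then (-(gapS Δ₀ k₁ k₂) : ℂ) else (-(xiS μ k₁ k₂) : ℂ))) +
        (if σ = σ' then (t : ℂ) * Complex.I else 0)) * symb μ Δ₀ t k₁ k₂ σ' σ'' =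
      if σ = σ'' then 1 else 0 := by
  have hD : (xiS μ k₁ k₂) ^ 2 + (gapS Δ₀ k₁ k₂) ^ 2 + t ^ 2 ≠ 0 := by positivity
  have hDc : ((xiS μ k₁ k₂ : ℂ)) ^ 2 + ((gapS Δ₀ k₁ k₂ : ℂ)) ^ 2 + (t : ℂ) ^ 2 ≠ 0 := by
    exact_mod_cast hD
  rw [Fin.sum_univ_two]
  unfold symb
  push_cast
  fin_cases σ <;> fin_cases σ'' <;> simp <;> field_simp <;> ring_nf <;> simp [Complex.I_sq]

end Symbol


/-! ### The free Nambu matrix on plane waves -/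

section PlaneWaves

variable {L : ℕ} [NeZero L]

/-- Casting a real `if-then-else` with vanishing `else` branch into `ℂ`. -/
private theorem ofReal_ite_zero (P : Prop) [Decidable P] (a : ℝ) :
    ((if P then a else 0 : ℝ) : ℂ) = if P then (a : ℂ) else 0 := by
  split_ifs <;> simp

/-- **Hopping stencil** of the free torus (`R = 0`, all signs `+1`):
`Σ_y τ₀(x,y) Φ(y) = −Σᵢ (Φ(x + eᵢ) + Φ(x − eᵢ))`. -/
theorem sum_visonHop_zero_mul (x : FermionTorus 2 L) (Φ : TorusSite 2 L → ℂ) :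
    ∑ y : FermionTorus 2 L, visonHop L 0 x y * Φ y.toTorusSite =
      -∑ i : Fin 2, (Φ (x.toTorusSite + Pi.single i 1) + Φ (x.toTorusSite - Pi.single i 1)) := by
  have h : ∀ y : FermionTorus 2 L, visonHop L 0 x y * Φ y.toTorusSite =
      ∑ i : Fin 2, ((if y.toTorusSite = x.toTorusSite + Pi.single i 1 then ((-1 : ℝ) : ℂ) else 0) *
          Φ y.toTorusSite +
        (if x.toTorusSite = y.toTorusSite + Pi.single i 1 then ((-1 : ℝ) : ℂ) else 0) *
          Φ y.toTorusSite) := by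
    intro y
    unfold visonHop
    simp only [sgn_zero_right, Complex.ofReal_sum, Complex.ofReal_add, ofReal_ite_zero,
      Finset.sum_mul, add_mul]
  simp_rw [h]
  rw [Finset.sum_comm, ← Finset.sum_neg_distrib]
  refine Finset.sum_congr rfl fun i _ => ?_
  rw [Finset.sum_add_distrib, sum_ite_shift_mul, sum_ite_unshift_mul]
  push_cast
  ring

/-- **Pairing stencil** of the free torus (`R = 0`): with `g = (1, −1)`,
`Σ_y (Δ(x,y) + Δ(y,x)) Φ(y) = Σᵢ Δ₀ gᵢ (Φ(x + eᵢ) + Φ(x − eᵢ))`. -/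
theorem sum_visonPair_zero_mul (Δ₀ : ℝ) (x : FermionTorus 2 L) (Φ : TorusSite 2 L → ℂ) :
    ∑ y : FermionTorus 2 L, (visonPair L Δ₀ 0 x y + visonPair L Δ₀ 0 y x) * Φ y.toTorusSite =
      ∑ i : Fin 2, ((Δ₀ * (if i = 0 then (1 : ℝ) else -1) : ℝ) : ℂ) *
        (Φ (x.toTorusSite + Pi.single i 1) + Φ (x.toTorusSite - Pi.single i 1)) := by
  have h : ∀ y : FermionTorus 2 L, (visonPair L Δ₀ 0 x y + visonPair L Δ₀ 0 y x) * Φ y.toTorusSite =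
      ∑ i : Fin 2, ((if y.toTorusSite = x.toTorusSite + Pi.single i 1 then
          ((Δ₀ * (if i = 0 then (1 : ℝ) else -1) : ℝ) : ℂ) else 0) * Φ y.toTorusSite +
        (if x.toTorusSite = y.toTorusSite + Pi.single i 1 then
          ((Δ₀ * (if i = 0 then (1 : ℝ) else -1) : ℝ) : ℂ) else 0) * Φ y.toTorusSite) := by
    intro y
    unfold visonPair
    simp only [sgn_zero_right, one_mul, Complex.ofReal_sum, ofReal_ite_zero, ← Finset.sum_add_distrib,
      Finset.sum_mul, add_mul]
  simp_rw [h]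
  rw [Finset.sum_comm]
  refine Finset.sum_congr rfl fun i _ => ?_
  rw [Finset.sum_add_distrib, sum_ite_shift_mul, sum_ite_unshift_mul]
  ring

/-- **The free Nambu matrix on plane waves**:
`Σ_y N₀((x,σ),(y,σ')) χ_k(y − w) = χ_k(x − w) N̂(k)_{σσ'}` with `N̂ = [[ξ, −Δ̂],[−Δ̂, −ξ]]` evaluated
at `kᵢ = 2π·(k i)/L`. -/
theorem sum_visonNambu_zero_mul_torusChar (μ Δ₀ : ℝ) (k w : TorusSite 2 L) (x : FermionTorus 2 L)
    (σ σ' : Fin 2) :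
    ∑ y : FermionTorus 2 L, visonNambu L μ Δ₀ 0 (orb x σ) (orb y σ') * torusChar k (y.toTorusSite - w) =
      torusChar k (x.toTorusSite - w) *
        (if σ = 0 then
          (if σ' = 0 then (xiS μ (2 * π * ((k 0).val : ℕ) / L) (2 * π * ((k 1).val : ℕ) / L) : ℂ)
            else (-(gapS Δ₀ (2 * π * ((k 0).val : ℕ) / L) (2 * π * ((k 1).val : ℕ) / L)) : ℂ))
        else
          (if σ' = 0 then (-(gapS Δ₀ (2 * π * ((k 0).val : ℕ) / L) (2 * π * ((k 1).val : ℕ) / L)) : ℂ)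
            else (-(xiS μ (2 * π * ((k 0).val : ℕ) / L) (2 * π * ((k 1).val : ℕ) / L)) : ℂ))) := by
  set χ : TorusSite 2 L → ℂ := fun v => torusChar k (v - w) with hχ
  have hst : ∀ i : Fin 2, χ (x.toTorusSite + Pi.single i 1) + χ (x.toTorusSite - Pi.single i 1) =
      2 * Real.cos (2 * π * ((k i).val : ℕ) / L) * χ x.toTorusSite := fun i => by
    simp only [hχ]
    exact torusChar_stencil k x.toTorusSite w i
  -- the two stencil sums on the plane wave
  have hH : ∑ y : FermionTorus 2 L, visonHop L 0 x y * χ y.toTorusSite =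
      -(2 * Real.cos (2 * π * ((k 0).val : ℕ) / L) + 2 * Real.cos (2 * π * ((k 1).val : ℕ) / L) : ℝ) *
        χ x.toTorusSite := by
    rw [sum_visonHop_zero_mul, Fin.sum_univ_two, hst, hst]
    push_cast
    ring
  have hP : ∑ y : FermionTorus 2 L, (visonPair L Δ₀ 0 x y + visonPair L Δ₀ 0 y x) * χ y.toTorusSite =
      (gapS Δ₀ (2 * π * ((k 0).val : ℕ) / L) (2 * π * ((k 1).val : ℕ) / L) : ℂ) * χ x.toTorusSite := by
    rw [sum_visonPair_zero_mul, Fin.sum_univ_two, hst, hst]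
    unfold gapS
    simp only [Fin.isValue, if_true, one_ne_zero, if_false]
    push_cast
    ring
  have hreal : ∀ y : FermionTorus 2 L, star (visonPair L Δ₀ 0 x y + visonPair L Δ₀ 0 y x) =
      visonPair L Δ₀ 0 x y + visonPair L Δ₀ 0 y x := fun y => by
    unfold visonPair
    rw [Complex.star_def, map_add, Complex.conj_ofReal, Complex.conj_ofReal]
  have hswap : ∀ y : FermionTorus 2 L, visonHop L 0 y x = visonHop L 0 x y := fun y =>
    visonHop_swap 0 y x
  change ∑ y : FermionTorus 2 L, visonNambu L μ Δ₀ 0 (orb x σ) (orb y σ') * χ y.toTorusSite =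
    χ x.toTorusSite * _
  simp only [visonNambu, bdgNambuMatrix_orb_orb, hreal, hswap]
  fin_cases σ <;> fin_cases σ' <;>
    simp only [Fin.isValue, Fin.zero_eta, Fin.mk_one, if_true, one_ne_zero, if_false]
  · -- (↑,↑): `Σ (τ − μδ) χ = ξ χ`
    simp only [sub_mul, Finset.sum_sub_distrib, hH, ite_mul, zero_mul, Finset.sum_ite_eq,
      Finset.mem_univ, if_true]
    unfold xiS
    push_cast
    ring
  · -- (↑,↓): `−Σ P χ = −Δ̂ χ`
    simp only [neg_mul, Finset.sum_neg_distrib, hP]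
    ring
  · -- (↓,↑)
    simp only [neg_mul, Finset.sum_neg_distrib, hP]
    ring
  · -- (↓,↓): `Σ (−τ + μδ) χ = −ξ χ`
    simp only [add_mul, neg_mul, Finset.sum_add_distrib, Finset.sum_neg_distrib, hH, ite_mul,
      zero_mul, Finset.sum_ite_eq, Finset.mem_univ, if_true]
    unfold xiS
    push_cast
    ring

/-- The free operator `N₀ + it` on plane waves: the symbol column `(N̂(k) + it)_{·σ'}`. -/
theorem sum_freeOp_mul_torusChar (μ Δ₀ t : ℝ) (k w : TorusSite 2 L) (x : FermionTorus 2 L)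
    (σ σ' : Fin 2) :
    ∑ y : FermionTorus 2 L, (visonNambu L μ Δ₀ 0 +
        ((t : ℂ) * Complex.I) • (1 : Matrix (Orb (FermionTorus 2 L)) (Orb (FermionTorus 2 L)) ℂ))
          (orb x σ) (orb y σ') * torusChar k (y.toTorusSite - w) =
      torusChar k (x.toTorusSite - w) *
        ((if σ = 0 then
          (if σ' = 0 then (xiS μ (2 * π * ((k 0).val : ℕ) / L) (2 * π * ((k 1).val : ℕ) / L) : ℂ)
            else (-(gapS Δ₀ (2 * π * ((k 0).val : ℕ) / L) (2 * π * ((k 1).val : ℕ) / L)) : ℂ))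
        else
          (if σ' = 0 then (-(gapS Δ₀ (2 * π * ((k 0).val : ℕ) / L) (2 * π * ((k 1).val : ℕ) / L)) : ℂ)
            else (-(xiS μ (2 * π * ((k 0).val : ℕ) / L) (2 * π * ((k 1).val : ℕ) / L)) : ℂ))) +
        (if σ = σ' then (t : ℂ) * Complex.I else 0)) := by
  have hI : ∑ y : FermionTorus 2 L, (((t : ℂ) * Complex.I) •
      (1 : Matrix (Orb (FermionTorus 2 L)) (Orb (FermionTorus 2 L)) ℂ)) (orb x σ) (orb y σ') *
        torusChar k (y.toTorusSite - w) =
      torusChar k (x.toTorusSite - w) * (if σ = σ' then (t : ℂ) * Complex.I else 0) := by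
    simp only [Matrix.smul_apply, Matrix.one_apply, orb_eq_orb_iff, smul_eq_mul, mul_ite, mul_one,
      mul_zero]
    by_cases hσ : σ = σ'
    · simp only [hσ, and_true, if_true, ite_mul, zero_mul, Finset.sum_ite_eq, Finset.mem_univ]
      ring
    · simp [hσ]
  simp only [Matrix.add_apply, add_mul, Finset.sum_add_distrib, hI, sum_visonNambu_zero_mul_torusChar]
  ring

/-! ### Fourier representation of the free resolvent -/

/-- **Fourier representation of the free resolvent**: for `t ≠ 0` and orbitals `a = (x,σ)`,
`b = (y,σ')`, with `n₁ = col(a) − col(b)`, `n₂ = row(a) − row(b)` in `ℤ/Lℤ`,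
`G_t(a,b) = L⁻² Σ_{j₁ j₂ < L} e^{2πi n₁ j₁/L} e^{2πi n₂ j₂/L} symb(2πj₁/L, 2πj₂/L)_{σσ'}`. -/
theorem freeG_apply_eq (μ Δ₀ : ℝ) {t : ℝ} (ht : t ≠ 0) (a b : Orb (FermionTorus 2 L)) :
    freeG L μ Δ₀ t a b = (1 / (L : ℂ) ^ 2) * ∑ j₁ : Fin L, ∑ j₂ : Fin L,
      Complex.exp (2 * π * Complex.I * ((colOf L a - colOf L b).val : ℕ) / L) ^ (j₁ : ℕ) *
        Complex.exp (2 * π * Complex.I * ((rowOf L a - rowOf L b).val : ℕ) / L) ^ (j₂ : ℕ) *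
          symb μ Δ₀ t (2 * π * (j₁ : ℕ) / L) (2 * π * (j₂ : ℕ) / L) (ofLex a).2 (ofLex b).2 := by
  have key := inv_apply_eq_sum_torusChar (d := 2)
    (visonNambu L μ Δ₀ 0 +
      ((t : ℂ) * Complex.I) • (1 : Matrix (Orb (FermionTorus 2 L)) (Orb (FermionTorus 2 L)) ℂ))
    (fun k σ σ' => (if σ = 0 then
          (if σ' = 0 then (xiS μ (2 * π * ((k 0).val : ℕ) / L) (2 * π * ((k 1).val : ℕ) / L) : ℂ)
            else (-(gapS Δ₀ (2 * π * ((k 0).val : ℕ) / L) (2 * π * ((k 1).val : ℕ) / L)) : ℂ))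
        else
          (if σ' = 0 then (-(gapS Δ₀ (2 * π * ((k 0).val : ℕ) / L) (2 * π * ((k 1).val : ℕ) / L)) : ℂ)
            else (-(xiS μ (2 * π * ((k 0).val : ℕ) / L) (2 * π * ((k 1).val : ℕ) / L)) : ℂ))) +
        (if σ = σ' then (t : ℂ) * Complex.I else 0))
    (fun k σ σ' => symb μ Δ₀ t (2 * π * ((k 0).val : ℕ) / L) (2 * π * ((k 1).val : ℕ) / L) σ σ')
    (fun k w x σ σ' => sum_freeOp_mul_torusChar μ Δ₀ t k w x σ σ')
    (fun k σ σ'' => symb_mul_key μ Δ₀ ht _ _ σ σ'') a b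
  unfold freeG
  rw [key, sum_torusChar_mul_eq_sum_fin_fin ((ofLex a).1.toTorusSite - (ofLex b).1.toTorusSite)
    (fun p q => symb μ Δ₀ t p q (ofLex a).2 (ofLex b).2)]
  simp only [colOf, rowOf, Pi.sub_apply, one_div, pow_two]

end PlaneWaves

/-! ### The stub -/

/-- One `(σ,σ')` term of a grid-line integral sum is bounded by the full sum over `(σ,σ')`. -/
private theorem single_le_sum_sum {L : ℕ} (I : Fin L → Fin 2 → Fin 2 → ℝ) (hI : ∀ j σ σ', 0 ≤ I j σ σ')
    (σ σ' : Fin 2) :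
    (1 / (L : ℝ)) * ∑ j : Fin L, I j σ σ' ≤ (1 / (L : ℝ)) * ∑ j : Fin L, ∑ τ : Fin 2, ∑ τ' : Fin 2, I j τ τ' := by
  refine mul_le_mul_of_nonneg_left (Finset.sum_le_sum fun j _ => ?_) (by positivity)
  calc I j σ σ' ≤ ∑ τ' : Fin 2, I j σ τ' :=
        Finset.single_le_sum (f := fun τ' => I j σ τ') (fun τ' _ => hI j σ τ') (Finset.mem_univ σ')
    _ ≤ ∑ τ : Fin 2, ∑ τ' : Fin 2, I j τ τ' :=
        Finset.single_le_sum (f := fun τ => ∑ τ' : Fin 2, I j τ τ')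
          (fun τ _ => Finset.sum_nonneg fun τ' _ => hI j τ τ') (Finset.mem_univ σ)

/-- **Stub `stub_freeResolventDecay`** of line `Sketch` (IR-5): decay of the free torus resolvent
`G_t = (N₀ + it)⁻¹` across columns and rows by periodic summation by parts in one momentum of its
exact Fourier representation. -/
theorem stub_freeResolventDecay : FreeResolventDecay := by
  intro L _ hL μ Δ₀ t ht a b
  have ht0 : t ≠ 0 := ht.ne'
  set n₁ : ZMod L := colOf L a - colOf L b with hn₁
  set n₂ : ZMod L := rowOf L a - rowOf L b with hn₂
  set σ : Fin 2 := (ofLex a).2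
  set σ' : Fin 2 := (ofLex b).2
  set ω₁ : ℂ := Complex.exp (2 * π * Complex.I * (n₁.val : ℕ) / L) with hω₁
  set ω₂ : ℂ := Complex.exp (2 * π * Complex.I * (n₂.val : ℕ) / L) with hω₂
  have hrep := freeG_apply_eq (L := L) μ Δ₀ ht0 a b
  have hcol : colDist L a b = min n₁.val (-n₁).val := by
    simp only [colDist, zdist, hn₁, neg_sub]
  have hrow : rowDist L a b = min n₂.val (-n₂).val := by
    simp only [rowDist, zdist, hn₂, neg_sub]
  have hω₁1 : ‖ω₁‖ = 1 := (exp_two_pi_natCast_div_pow_eq_one (L := L) n₁.val).2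
  have hω₂1 : ‖ω₂‖ = 1 := (exp_two_pi_natCast_div_pow_eq_one (L := L) n₂.val).2
  have hInn : ∀ (f : ℝ → ℂ), 0 ≤ ∫ x in (0 : ℝ)..(2 * π), ‖f x‖ := fun f =>
    intervalIntegral.integral_nonneg Real.two_pi_pos.le fun x _ => norm_nonneg _
  constructor
  · -- column direction: summation by parts in `j₁`
    intro hd
    have hn : n₁ ≠ 0 := by
      intro h
      rw [hcol, h] at hd
      simp at hd
    have key := norm_twisted_double_grid_sum_le n₁ hn (fun j₂ => ω₂ ^ (j₂ : ℕ))
      (fun j₂ => by rw [norm_pow, hω₂1, one_pow]) (fun s r => symb μ Δ₀ t s r σ σ')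
      (fun r => symb_contDiff_left μ Δ₀ ht0 r σ σ') (fun r => symb_periodic_left μ Δ₀ t r σ σ')
    beta_reduce at key
    rw [hrep, hcol]
    refine ⟨key.1.trans ?_, key.2.trans ?_⟩
    · refine div_le_div_of_nonneg_right ?_ (by positivity)
      exact single_le_sum_sum (fun j τ τ' => ∫ x in (0 : ℝ)..(2 * π),
        ‖deriv (fun s => symb μ Δ₀ t s (2 * π * (j : ℕ) / L) τ τ') x‖) (fun _ _ _ => hInn _) σ σ'
    · refine div_le_div_of_nonneg_right (mul_le_mul_of_nonneg_left ?_ (by positivity)) (by positivity)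
      exact single_le_sum_sum (fun j τ τ' => ∫ x in (0 : ℝ)..(2 * π),
        ‖iteratedDeriv 2 (fun s => symb μ Δ₀ t s (2 * π * (j : ℕ) / L) τ τ') x‖)
        (fun _ _ _ => hInn _) σ σ'
  · -- row direction: the same argument with the roles of `j₁`, `j₂` exchanged
    intro hd
    have hn : n₂ ≠ 0 := by
      intro h
      rw [hrow, h] at hd
      simp at hd
    have key := norm_twisted_double_grid_sum_le n₂ hn (fun j₁ => ω₁ ^ (j₁ : ℕ))
      (fun j₁ => by rw [norm_pow, hω₁1, one_pow]) (fun s r => symb μ Δ₀ t r s σ σ')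
      (fun r => symb_contDiff_right μ Δ₀ ht0 r σ σ') (fun r => symb_periodic_right μ Δ₀ t r σ σ')
    have hrep' : freeG L μ Δ₀ t a b = (1 / (L : ℂ) ^ 2) * ∑ j₂ : Fin L, ∑ j₁ : Fin L,
        ω₂ ^ (j₂ : ℕ) * ω₁ ^ (j₁ : ℕ) *
          symb μ Δ₀ t (2 * π * (j₁ : ℕ) / L) (2 * π * (j₂ : ℕ) / L) σ σ' := by
      rw [hrep, Finset.sum_comm]
      congr 1
      exact Finset.sum_congr rfl fun j₂ _ => Finset.sum_congr rfl fun j₁ _ => by ring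
    beta_reduce at key
    rw [hrep', hrow]
    refine ⟨key.1.trans ?_, key.2.trans ?_⟩
    · refine div_le_div_of_nonneg_right ?_ (by positivity)
      exact single_le_sum_sum (fun j τ τ' => ∫ x in (0 : ℝ)..(2 * π),
        ‖deriv (fun s => symb μ Δ₀ t (2 * π * (j : ℕ) / L) s τ τ') x‖) (fun _ _ _ => hInn _) σ σ'
    · refine div_le_div_of_nonneg_right (mul_le_mul_of_nonneg_left ?_ (by positivity)) (by positivity)
      exact single_le_sum_sum (fun j τ τ' => ∫ x in (0 : ℝ)..(2 * π),
        ‖iteratedDeriv 2 (fun s => symb μ Δ₀ t (2 * π * (j : ℕ) / L) s τ τ') x‖)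
        (fun _ _ _ => hInn _) σ σ'
end Summit.HubbardSuperconductivity.HubbardSuperconductivity.Theorems.VisonPairCost

end
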